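import Mathlib
import HarnessLib
import Literature.MathematicalPhysics.QuantumFieldTheory.ConstructiveQFTWave0
import Summits.Ventures.LatticeQCDFlow.Scaling.Conjectures

/-!
# LatticeQCDFlow / Scaling — the conjecture items (U′), (U″), (C2a) REPAIRED after row 30's
negative edges (v2.5)

HONEST FRAMING: exact (Metropolis-corrected) sampling algorithms for lattice gauge theory; figures
of merit are autocorrelation/cost numbers at stated couplings and volumes; no continuum-physics
claim.

Venture `LatticeQCDFlow` (cell pub-lqcd), topic `Scaling`, FANOUT row 29 (theory2) — OUR WORK
(THEORY-2.md v2.5 §3.1 / §3.3 / §4 rows (U′), (U″), C2).  These are OUR conjectures, typed; nothing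
here is a Literature fact.

The landing seat (row 30, lean-1) settled the three typed conjecture items of
`Scaling/Conjectures.lean` at their DEGENERATE parameters:
* `CrossCutCorrelatorFloor d N G ρ β R i j a` and `ClusteringFloor d N G ρ β i j a` are FALSE for
  `i = j` (`Scaling/CorrelatorFloorDegenerate.lean`: the "plaquette" in the plane `(i, i)` has
  trivial holonomy, the observable is the constant `N`, a constant has no connected correlator) —
  class MISSTATED: the items were meant for a genuine plane `i ≠ j` and, by their own docstrings,
  for `d ≥ 3` (in `d = 2` plaquettes are independent in infinite volume);
* `ExactTransportBiLipschitz d N G ρ` is a THEOREM for `SU(N)` and `U(N)`, `N ≥ 2`, `d ≥ 2`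
  (`Scaling/ExactTransportSUN.lean`, `Scaling/ExactTransportUN.lean`, all `L ≥ 1`) and FALSE for
  `d ≤ 1` and for commutative `G` (`Scaling/ExactTransportDegenerate.lean`: at `L = 1` every
  plaquette of an abelian theory is `U V U⁻¹ V⁻¹ = 1`, the Wilson action vanishes and the identity
  is an exact `1`-bi-Lipschitz transport) — class MISSTATED for abelian `G`: the intended content
  is `L ≥ 2`.

This file types the REPAIRED items, leaving the refuted ones in place as settled negative edges:
* `CrossCutCorrelatorFloorR … i j a := 3 ≤ d → i ≠ j → 0 < β → (∃ g, Re tr ρ g ≠ N) →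
  CrossCutCorrelatorFloor … i j a` — (U′-R);
* `ClusteringFloorR … i j a := 3 ≤ d → i ≠ j → 0 < β → (∃ g, Re tr ρ g ≠ N) → ClusteringFloor …`
  — (U″-R);
* `ExactTransportBiLipschitzR d N G ρ := 2 ≤ d → Infinite G → (∃ g, Re tr ρ g ≠ N) → (C2a with
  the volume quantifier restricted to 2 ≤ L)` — (C2a-R);
the guards beyond row 30's two negative edges (`β > 0`, non-constant character, `2 ≤ d`,
`Infinite G`) pre-empt the next degenerate families on which the unguarded items are FALSE for
the same trivial reasons (product measure at `β = 0`; constant observable / vanishing action;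
no plaquettes; finite `G`, where every bijection is boundedly bi-Lipschitz);
with the bookkeeping lemmas: the repaired items are vacuous at the degenerate parameters
(`…_diag`, `…_of_lt_three`, `…_of_nonpos`, `…_of_trivial`, `…_of_lt_two`, `…_of_finite`), they
are implied by the
unrepaired ones (`…R_of`), they give them back at genuine parameters (`….floor`), and (C2a-R) holds
for `SU(N)`, `N ≥ 2`, `d ≥ 2` by row 30's theorem (`exactTransportBiLipschitzR_of`; the instance
`SUN.exactTransportBiLipschitzR` is the companion file `Scaling/ExactTransportSUNRepaired.lean`).
What stays OPEN as typed: (U′-R)/(U″-R) at every `β` in their volume-uniformity (theorems at strong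
coupling by the cluster expansion, not formalised), and (C2a-R) for ABELIAN `G` — e.g. `U(1)`,
`d ≥ 2`, `L ≥ 2`, where the Wilson action is extensive (`∃ V, s₀·L^d ≤ S(V)` for `L ≥ 2`) and row
30's `exactTransportBiLipschitz_of_ballVolumes` goes through verbatim once its hypothesis `hconf`
and its conclusion are both restricted to `2 ≤ L`.
-/

namespace Summit.Ventures.LatticeQCDFlow.Conjectures

open MeasureTheory Literature.MathematicalPhysics.QuantumFieldTheory

section Correlator

variable (d N : ℕ) (G : Type) [Group G] [TopologicalSpace G] [IsTopologicalGroup G]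
  [CompactSpace G] [MeasurableSpace G] [BorelSpace G] (ρ : G →* Matrix (Fin N) (Fin N) ℂ)

/-- **(U′-R) reduced volume-law hypothesis, REPAIRED (THEORY-2.md §3.1, v2.5):** the cross-cut
connected plaquette–plaquette correlator floor `CrossCutCorrelatorFloor d N G ρ β R i j a`, asserted
only for a genuine plaquette plane `i ≠ j` in dimension `d ≥ 3`, at a coupling `β > 0`, for a
representation with non-constant character (`∃ g, Re tr ρ(g) ≠ N`).  Each guard removes a
degenerate family on which the unguarded item is FALSE: `i = j` (row 30's
`not_crossCutCorrelatorFloor_diag`), `d = 2` (plaquettes independent in infinite volume), `β = 0`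
(product Haar measure: distinct plaquettes independent), trivial `ρ` or `N = 0` (constant
observable).  Status: THEOREM at strong coupling (cluster expansion, `|⟨P;P⟩| ≍ (β/2N²)^{area}`),
conjectural at intermediate `β` only in its uniformity in `L`.  Cheapest falsifier: 3-d `Z₂`/`U(1)`
inside the strong-coupling disc, `L = 8, 12, 16`, character-expansion numbers vs Monte Carlo. -/
@[conjecture]
def CrossCutCorrelatorFloorR (β : ℝ) (R : ℕ) (i j a : Fin d) : Prop :=
  3 ≤ d → i ≠ j → 0 < β → (∃ g : G, (ρ g).trace.re ≠ N) →
    CrossCutCorrelatorFloor d N G ρ β R i j a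

/-- **(U″-R) clustering floor, REPAIRED (THEORY-2.md §3.1, v2.5):**
`ClusteringFloor d N G ρ β i j a` asserted only for `i ≠ j`, `d ≥ 3`, `β > 0` and a non-constant
character `∃ g, Re tr ρ(g) ≠ N` (the instances `i = j` are FALSE — row 30's
`not_clusteringFloor_diag`; so are `β = 0` and trivial `ρ`, constant observables again).  Same
status and falsifier as (U′-R); implies (U′-R) for every `R` whenever the unrepaired implication is
available (`s = 2R + 1`). -/
@[conjecture]
def ClusteringFloorR (β : ℝ) (i j a : Fin d) : Prop :=
  3 ≤ d → i ≠ j → 0 < β → (∃ g : G, (ρ g).trace.re ≠ N) → ClusteringFloor d N G ρ β i j a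

variable {d N G ρ}

/-- The repaired item is implied by the unrepaired one. [folklore] -/
theorem crossCutCorrelatorFloorR_of {β : ℝ} {R : ℕ} {i j a : Fin d}
    (h : CrossCutCorrelatorFloor d N G ρ β R i j a) : CrossCutCorrelatorFloorR d N G ρ β R i j a :=
  fun _ _ _ _ => h

/-- At genuine parameters the repaired item gives the floor back. [folklore] -/
theorem CrossCutCorrelatorFloorR.floor {β : ℝ} {R : ℕ} {i j a : Fin d}
    (h : CrossCutCorrelatorFloorR d N G ρ β R i j a) (hd : 3 ≤ d) (hij : i ≠ j) (hβ : 0 < β)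
    (hρ : ∃ g : G, (ρ g).trace.re ≠ N) : CrossCutCorrelatorFloor d N G ρ β R i j a :=
  h hd hij hβ hρ

/-- The repaired item is (vacuously) TRUE at the refuted degenerate plane `i = j`. [folklore] -/
theorem crossCutCorrelatorFloorR_diag (β : ℝ) (R : ℕ) (i a : Fin d) :
    CrossCutCorrelatorFloorR d N G ρ β R i i a :=
  fun _ h _ _ => (h rfl).elim

/-- The repaired item is (vacuously) TRUE in dimension `d ≤ 2`. [folklore] -/
theorem crossCutCorrelatorFloorR_of_lt_three (hd : d < 3) (β : ℝ) (R : ℕ) (i j a : Fin d) :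
    CrossCutCorrelatorFloorR d N G ρ β R i j a :=
  fun h _ _ _ => absurd h (not_le.2 hd)

/-- The repaired item is (vacuously) TRUE at couplings `β ≤ 0` (at `β = 0` the unguarded item is
FALSE: product Haar measure). [folklore] -/
theorem crossCutCorrelatorFloorR_of_nonpos {β : ℝ} (hβ : β ≤ 0) (R : ℕ) (i j a : Fin d) :
    CrossCutCorrelatorFloorR d N G ρ β R i j a :=
  fun _ _ h _ => absurd h (not_lt.2 hβ)

/-- The repaired item is (vacuously) TRUE for a representation with constant character (trivial
`ρ`, or `N = 0`), where the unguarded item is FALSE (constant observable). [folklore] -/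
theorem crossCutCorrelatorFloorR_of_trivial (hρ : ∀ g : G, (ρ g).trace.re = N) (β : ℝ) (R : ℕ)
    (i j a : Fin d) : CrossCutCorrelatorFloorR d N G ρ β R i j a :=
  fun _ _ _ h => by obtain ⟨g, hg⟩ := h; exact absurd (hρ g) hg

/-- The repaired clustering item is implied by the unrepaired one. [folklore] -/
theorem clusteringFloorR_of {β : ℝ} {i j a : Fin d} (h : ClusteringFloor d N G ρ β i j a) :
    ClusteringFloorR d N G ρ β i j a :=
  fun _ _ _ _ => h

/-- At genuine parameters the repaired clustering item gives the floor back. [folklore] -/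
theorem ClusteringFloorR.floor {β : ℝ} {i j a : Fin d} (h : ClusteringFloorR d N G ρ β i j a)
    (hd : 3 ≤ d) (hij : i ≠ j) (hβ : 0 < β) (hρ : ∃ g : G, (ρ g).trace.re ≠ N) :
    ClusteringFloor d N G ρ β i j a :=
  h hd hij hβ hρ

/-- The repaired clustering item is (vacuously) TRUE at `i = j`. [folklore] -/
theorem clusteringFloorR_diag (β : ℝ) (i a : Fin d) : ClusteringFloorR d N G ρ β i i a :=
  fun _ h _ _ => (h rfl).elim

/-- The repaired clustering item is (vacuously) TRUE in dimension `d ≤ 2`. [folklore] -/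
theorem clusteringFloorR_of_lt_three (hd : d < 3) (β : ℝ) (i j a : Fin d) :
    ClusteringFloorR d N G ρ β i j a :=
  fun h _ _ _ => absurd h (not_le.2 hd)

/-- The repaired clustering item is (vacuously) TRUE at `β ≤ 0`. [folklore] -/
theorem clusteringFloorR_of_nonpos {β : ℝ} (hβ : β ≤ 0) (i j a : Fin d) :
    ClusteringFloorR d N G ρ β i j a :=
  fun _ _ h _ => absurd h (not_lt.2 hβ)

/-- The repaired clustering item is (vacuously) TRUE for a constant character. [folklore] -/
theorem clusteringFloorR_of_trivial (hρ : ∀ g : G, (ρ g).trace.re = N) (β : ℝ) (i j a : Fin d) :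
    ClusteringFloorR d N G ρ β i j a :=
  fun _ _ _ h => by obtain ⟨g, hg⟩ := h; exact absurd (hρ g) hg

end Correlator

section Transport

/-- **(C2a-R) exact transport of the Haar prior onto the Wilson law is `e^{cβ}`-bi-Lipschitz,
REPAIRED (THEORY-2.md §3.3, v2.5):** the statement of `ExactTransportBiLipschitz` with the volume
quantifier restricted to `L ≥ 2`, guarded by `2 ≤ d` (no plaquettes below), `Infinite G` (for a
FINITE gauge group every bijection is boundedly bi-Lipschitz and the item is FALSE) and a
non-constant character `∃ g, Re tr ρ(g) ≠ N` (else the action vanishes identically).  The unrepaired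
item quantifies over `L = 1` too, where an ABELIAN theory has identically vanishing Wilson action
and the item is FALSE (row 30's `not_exactTransportBiLipschitz_of_comm`); for `SU(N)`/`U(N)`,
`N ≥ 2`, `d ≥ 2` the unrepaired item is a THEOREM (row 30), hence so is this one
(`exactTransportBiLipschitzR_of`).  OPEN as typed: abelian `G` (e.g. `U(1)`), `d ≥ 2` — in substance
the same density-ratio / ball-volume argument with an extensive-action configuration, which exists
exactly when `L ≥ 2` (`U(x, e₀) = g^{x₁}` for any `g` with `Re tr ρ(g) < N` makes all but `L^{d−1}`
of the `(e₀, e₁)`-plaquettes equal to `g⁻¹`).  Intended range: compact Lie groups with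
Ahlfors-regular Haar measure (`U(N)`, `SU(N)`, `U(1)`); profinite `G` is outside the venture.
Cheapest falsifier: `U(1)`, `d = 2`, `L = 2`, the explicit inverse-CDF transport of one von Mises
factor. -/
@[conjecture]
def ExactTransportBiLipschitzR (d N : ℕ) (G : Type) [Group G] [MetricSpace G]
    [IsTopologicalGroup G] [CompactSpace G] [MeasurableSpace G] [BorelSpace G]
    (ρ : G →* Matrix (Fin N) (Fin N) ℂ) : Prop :=
  2 ≤ d → Infinite G → (∃ g : G, (ρ g).trace.re ≠ N) →
  ∃ c : ℝ, 0 < c ∧ ∃ β₀ : ℝ, ∀ (L : ℕ) [NeZero L], 2 ≤ L → ∀ β : ℝ, β₀ ≤ β →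
    ∀ (T : GaugeConfig d L G → GaugeConfig d L G) (K K' : NNReal),
      LipschitzWith K T → AntilipschitzWith K' T →
      (Measure.pi fun _ : Edge d L => haarProbability G).map T =
          wilsonMeasure (d := d) (L := L) ρ β →
      Real.exp (c * β) ≤ (K : ℝ) * K'

variable {d N : ℕ} {G : Type} [Group G] [MetricSpace G] [IsTopologicalGroup G] [CompactSpace G]
  [MeasurableSpace G] [BorelSpace G] {ρ : G →* Matrix (Fin N) (Fin N) ℂ}

/-- The repaired item is implied by the unrepaired one (drop the volumes `L = 1`). [folklore] -/
theorem exactTransportBiLipschitzR_of (h : ExactTransportBiLipschitz d N G ρ) :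
    ExactTransportBiLipschitzR d N G ρ := by
  intro _ _ _
  obtain ⟨c, hc, β₀, h⟩ := h
  exact ⟨c, hc, β₀, fun L _ _ β hβ T K K' hT hT' hmap => h L β hβ T K K' hT hT' hmap⟩

/-- The repaired item is (vacuously) TRUE in dimension `d ≤ 1`, where the unguarded item is FALSE
(row 30's `not_exactTransportBiLipschitz_of_le_one`). [folklore] -/
theorem exactTransportBiLipschitzR_of_lt_two (hd : d < 2) : ExactTransportBiLipschitzR d N G ρ :=
  fun h _ _ => absurd h (not_le.2 hd)

/-- The repaired item is (vacuously) TRUE for a finite gauge group. [folklore] -/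
theorem exactTransportBiLipschitzR_of_finite [Finite G] : ExactTransportBiLipschitzR d N G ρ :=
  fun _ _ _ => (not_finite G).elim

/-- The repaired item is (vacuously) TRUE for a representation with constant character (where the
Wilson action vanishes identically and the unguarded item is FALSE). [folklore] -/
theorem exactTransportBiLipschitzR_of_trivial (hρ : ∀ g : G, (ρ g).trace.re = N) :
    ExactTransportBiLipschitzR d N G ρ :=
  fun _ _ h => by obtain ⟨g, hg⟩ := h; exact absurd (hρ g) hg

end Transport

end Summit.Ventures.LatticeQCDFlow.Conjectures
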